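import Literature.Probability.Percolation.IsoradialBoxBootstrap
import Literature.Probability.Percolation.IsoradialDualityExclusion
import HarnessLib

/-!
# Two-sided box-crossing bounds on an isoradial rhombic tiling from aspect-ratio-2 inputs

The tree renders Grimmett–Manolescu's box-crossing property (PTRF 159 (2014) = arXiv:1204.0505,
§2.3 Def. 2.2, §3 Thm 3.1 / (3.1)) as `BoxCrossingBounds μ z ρ c n₀`
(`Literature.Probability.LatticeModels.IsoradialPercolation`): for all `n ≥ n₀` and all
translations, horizontal crossings of `ρ n × n` boxes and vertical crossings of `n × ρ n` boxes
have probability in `[c, 1 - c]`. The paper proves, for `G ∈ 𝒢`, the box-crossing property in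
its own sense — lower bounds, for which aspect ratio `2` and the two axis-parallel orientations
suffice (§2.3) — for `G` **and for its dual `G*`** (end of §3: "both `P_G` and `P_{G*}` have the
box-crossing property"), the upper bounds being planar duality (§2.2). This file assembles the
rendering from exactly these inputs, for an isoradial rhombic tiling with countably many
vertices and faces and without coincidences of vertex and face-centre positions (`hclash`, see
`IsoradialDualityExclusion`):

* `real_embRectCrossing_le_one_sub_of_dual_lower` — **upper bound for horizontal crossings**
  from a lower bound for vertical dual crossings (`real_embRectCrossing_le_one_sub_dual` applied
  to an inner strip, `embTBCrossing_mono_height` for the dual embedding);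
* `dual_reflect` — reflecting commutes with dualising (definitionally), so vertical statements
  follow from horizontal ones (`IsoradialReflection`);
* **`boxCrossingBounds_of_aspect_two`** — if `P_G` crosses `2n × n` boxes horizontally and
  `n × 2n` boxes vertically with probability `≥ δ` from scale `n₀` on, and so does `P_{G*}` for
  the dual drawing, then `BoxCrossingBounds P_G z ρ (boxConst δ ρ) (boxScale n₀ ρ)` for every
  `ρ > 0`, with the **explicit** constants `boxConst`, `boxScale` depending on `(δ, n₀, ρ)` only —
  as needed for the uniform statement `gm_boxCrossingBounds_uniform`, whose remaining content is
  thereby reduced to the aspect-ratio-2 lower bounds for the class `𝒢` (Thm 3.1 proper, §§5–7)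
  and the no-clash property of rhombic tilings of preconnected graphs.

## References

* G. R. Grimmett, I. Manolescu, *Bond percolation on isoradial graphs: criticality and
  universality*, PTRF 159 (2014), arXiv:1204.0505, §2.2, §2.3, §3.
* G. Grimmett, *Percolation*, 2nd ed. (1999), §11.2, §11.7.
-/

noncomputable section

namespace Literature.Probability.Percolation

open MeasureTheory Complex Set
open Literature.Probability.LatticeModels Literature.Probability.LatticeModels.RhombicEmbedding

variable {V F : Type*} {G : SimpleGraph V} {emb : RhombicEmbedding G F}

/-! ### Reflection commutes with duality -/

/-- The dual graph of the reflected embedding is the dual graph (faces are unchanged). [folklore] -/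
theorem dualGraph_reflect : emb.reflect.dualGraph = emb.dualGraph := rfl

/-- **Reflecting commutes with dualising**, definitionally. [folklore] -/
theorem dual_reflect : emb.reflect.dual = emb.dual.reflect := rfl

/-- The no-clash hypothesis is invariant under reflection. [folklore] -/
theorem noClash_reflect (hclash : ∀ d D : G.Dart, emb.z d.fst ≠ emb.c (emb.leftFace D)) :
    ∀ d D : G.Dart, emb.reflect.z d.fst ≠ emb.reflect.c (emb.reflect.leftFace D) :=
  fun d D h => hclash d D (swapXY_injective h)

/-! ### Upper bounds from dual lower bounds -/

section Upper

variable [Countable V] [Countable F]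

/-- Narrowing the horizontal window of a vertical crossing event shrinks it. [folklore] -/
theorem embTBCrossing_mono_width {W : Type*} {zW : W → ℂ} {w : ℂ} {a a' b : ℝ} (haa' : a ≤ a') :
    embTBCrossing (fun v => zW v - w) a b ⊆ embTBCrossing (fun v => zW v - w) a' b := by
  intro ω h
  rw [mem_embTBCrossing_iff] at h ⊢
  obtain ⟨x, y, p, hx, hy, hp⟩ := h
  refine ⟨x, y, p, hx, hy, fun v hv => ?_⟩
  obtain ⟨⟨h1, h2⟩, h3⟩ := hp v hv
  exact ⟨⟨h1, h2.trans haa'⟩, h3⟩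

/-- **Upper bound for horizontal crossings from a lower bound for vertical dual crossings.**
Suppose the dual drawing crosses vertically the `m × ρ'' m` boxes with `P_{G*}`-probability
`≥ c'` for `m ≥ n₁'`. Then for `n` with `n₁' + 3 ≤ ρ n`, `1 ≤ n` and `n + 2 ≤ ρ'' (⌊ρ n⌋ - 2)`,
the horizontal crossing of every `ρ n × n` box has `P_G`-probability `≤ 1 - c'`: the dual
crossing of the tall thin box `w + 1 - 2i + [0, m] × [0, ρ'' m]`, `m = ⌊ρ n⌋ - 2`, contains one
of the inner strip `w + 1 - 2i + [0, m] × [0, n + 2]`, which excludes the primal crossing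
(`real_embRectCrossing_le_one_sub_dual`). [cite: GrimmettManolescu2014Isoradial, §2.2 and end of §3 (duality for box crossings)] -/
theorem real_embRectCrossing_le_one_sub_of_dual_lower (hiso : emb.IsIsoradial)
    (hrh : emb.IsRhombicTiling) (hclash : ∀ d D : G.Dart, emb.z d.fst ≠ emb.c (emb.leftFace D))
    {c' ρ'' : ℝ} {n₁' : ℕ}
    (hdual : ∀ m : ℕ, n₁' ≤ m → ∀ w : ℂ, c' ≤ emb.dual.isoradialPercolation.real
      (embTBCrossing (fun f => emb.dual.z f - w) m (ρ'' * m)))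
    {ρ : ℝ} {n : ℕ} (hn1 : 1 ≤ n) (hnρ : (n₁' : ℝ) + 3 ≤ ρ * n)
    (hn'' : (n : ℝ) + 2 ≤ ρ'' * ((⌊ρ * n⌋₊ - 2 : ℕ) : ℝ)) (w : ℂ) :
    emb.isoradialPercolation.real (embRectCrossing (fun v => emb.z v - w) (ρ * n) n) ≤ 1 - c' := by
  set m : ℕ := ⌊ρ * n⌋₊ - 2 with hm
  have hρn0 : (0 : ℝ) ≤ ρ * n := le_trans (by positivity) hnρ
  have hfl : (n₁' + 3 : ℕ) ≤ ⌊ρ * n⌋₊ := Nat.le_floor (by push_cast; exact hnρ)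
  have hm₁ : n₁' ≤ m := by omega
  have hm1 : 1 ≤ m := by omega
  have hmle : (m : ℝ) ≤ ρ * n - 2 := by
    have h1 : ((⌊ρ * n⌋₊ : ℕ) : ℝ) ≤ ρ * n := Nat.floor_le hρn0
    have h2 : (m : ℝ) = (⌊ρ * n⌋₊ : ℕ) - 2 := by
      rw [hm, Nat.cast_sub (by omega)]; norm_num
    linarith
  set w' : ℂ := w + 1 - 2 * I with hw'
  -- exclusion with the inner strip `w' + [0, m] × [0, n + 2]`
  have hexcl := real_embRectCrossing_le_one_sub_dual hiso hrh hclash (w := w) (w' := w')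
    (a := ρ * n) (b := n) (a' := m) (b' := n + 2) (by exact_mod_cast hm1) (by exact_mod_cast hn1)
    (by simp [hw']) (by simp [hw']; linarith) (by simp [hw']) (by simp [hw'])
  -- the dual crossing of the tall box contains that of the inner strip
  have hmono : embTBCrossing (fun f => emb.dual.z f - w') m (ρ'' * m) ∩
      {ω' | ω' ⊆ emb.dualGraph.edgeSet} ⊆ embTBCrossing (fun f => emb.c f - w') m (n + 2) := by
    rintro ω' ⟨hω', hω'E⟩
    exact embTBCrossing_mono_height (emb := emb.dual) (isIsoradial_dual hiso hrh) hω'E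
      (by positivity) hn'' hω'
  have hlow : c' ≤ emb.dual.isoradialPercolation.real
      (embTBCrossing (fun f => emb.c f - w') m (n + 2)) := by
    calc c' ≤ _ := hdual m hm₁ w'
      _ = _ := (isoradialPercolation_real_inter_subset (emb := emb.dual) _).symm
      _ ≤ _ := measureReal_mono hmono
  linarith

end Upper

/-! ### The constants -/

/-- The box-crossing constant obtained from aspect-ratio-2 crossing probabilities `≥ δ`, at
aspect ratio `ρ`: `δ ^ (2 ⌈2ρ⌉ + 2 ⌈8/ρ⌉ + 2)` (below both the lower-bound constant
`δ ^ (2⌈2ρ⌉ + 1)` of `exists_boxCrossing_lower_of_two` and the dual one at ratio `4/ρ`).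
Depends on `(δ, ρ)` only. [folklore] -/
def boxConst (δ ρ : ℝ) : ℝ := δ ^ (2 * ⌈2 * ρ⌉₊ + 2 * ⌈8 / ρ⌉₊ + 2)

/-- The scale from which the assembled box-crossing bounds hold, from the input scale `n₀` and
the aspect ratio `ρ`. Depends on `(n₀, ρ)` only. [folklore] -/
def boxScale (n₀ : ℕ) (ρ : ℝ) : ℕ :=
  max (max (n₀ + 4) 8) (max (⌈((max (n₀ + 4) 8 : ℕ) + 3) / ρ⌉₊) (⌈(2 + 12 / ρ) / 3⌉₊ + 1))

/-- `boxConst` is positive for `δ > 0`. [folklore] -/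
theorem boxConst_pos {δ : ℝ} (hδ : 0 < δ) (ρ : ℝ) : 0 < boxConst δ ρ := by
  unfold boxConst; positivity

/-! ### Assembly -/

section Assembly

variable [Countable V] [Countable F]

/-- One orientation of the assembly: lower and upper bounds for the horizontal crossings of the
`ρ n × n` boxes, `n ≥ boxScale n₀ ρ`. [cite: GrimmettManolescu2014Isoradial, §2.3 and end of §3] -/
theorem embRectCrossing_bounds_of_aspect_two (hiso : emb.IsIsoradial) (hrh : emb.IsRhombicTiling)
    (hclash : ∀ d D : G.Dart, emb.z d.fst ≠ emb.c (emb.leftFace D)) {δ : ℝ} (hδ : 0 < δ)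
    (hδ1 : δ ≤ 1) {n₀ : ℕ}
    (hLR : ∀ n : ℕ, n₀ ≤ n → ∀ w : ℂ,
      δ ≤ emb.isoradialPercolation.real (embRectCrossing (fun v => emb.z v - w) (2 * n) n))
    (hTB : ∀ n : ℕ, n₀ ≤ n → ∀ w : ℂ,
      δ ≤ emb.isoradialPercolation.real (embTBCrossing (fun v => emb.z v - w) n (2 * n)))
    (hLRd : ∀ n : ℕ, n₀ ≤ n → ∀ w : ℂ, δ ≤ emb.dual.isoradialPercolation.real
      (embRectCrossing (fun f => emb.dual.z f - w) (2 * n) n))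
    (hTBd : ∀ n : ℕ, n₀ ≤ n → ∀ w : ℂ, δ ≤ emb.dual.isoradialPercolation.real
      (embTBCrossing (fun f => emb.dual.z f - w) n (2 * n)))
    {ρ : ℝ} (hρ : 0 < ρ) {n : ℕ} (hn : boxScale n₀ ρ ≤ n) (w : ℂ) :
    boxConst δ ρ ≤ emb.isoradialPercolation.real (embRectCrossing (fun v => emb.z v - w) (ρ * n) n) ∧
      emb.isoradialPercolation.real (embRectCrossing (fun v => emb.z v - w) (ρ * n) n) ≤
        1 - boxConst δ ρ := by
  have hN : max (n₀ + 4) 8 ≤ n := le_trans (le_max_left _ _) hn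
  have hN2 : ⌈((max (n₀ + 4) 8 : ℕ) + 3) / ρ⌉₊ ≤ n :=
    le_trans (le_trans (le_max_left _ _) (le_max_right _ _)) hn
  have hN3 : ⌈(2 + 12 / ρ) / 3⌉₊ + 1 ≤ n :=
    le_trans (le_trans (le_max_right _ _) (le_max_right _ _)) hn
  have hn8 : (8 : ℝ) ≤ n := by exact_mod_cast le_trans (le_max_right _ _) hN
  constructor
  · -- lower bound, `exists_boxCrossing_lower_of_two` with its explicit constant
    have h := boxCrossing_lower_horizontal_of_two hiso hrh hδ.le hLR hTB hρ hN w
    refine le_trans ?_ h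
    unfold boxConst
    rw [← pow_add]
    exact pow_le_pow_of_le_one hδ.le hδ1 (by omega)
  · -- upper bound from the dual lower bounds at aspect ratio `4/ρ`
    have hρ' : (0 : ℝ) < 4 / ρ := by positivity
    have hdual : ∀ m : ℕ, max (n₀ + 4) 8 ≤ m → ∀ w : ℂ,
        δ ^ (⌈2 * (4 / ρ)⌉₊ + 1) * δ ^ ⌈2 * (4 / ρ)⌉₊ ≤ emb.dual.isoradialPercolation.real
          (embTBCrossing (fun f => emb.dual.z f - w) m (4 / ρ * m)) := fun m hm w' => by
      have h := exists_boxCrossing_lower_of_two (emb := emb.dual) (isIsoradial_dual hiso hrh)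
        (isRhombicTiling_dual hiso hrh) hδ hLRd hTBd hρ'
      -- use the explicit-constant form directly
      have h2 := boxCrossing_lower_horizontal_of_two (emb := emb.dual.reflect)
        (isIsoradial_dual hiso hrh).reflect (isRhombicTiling_dual hiso hrh).reflect hδ.le
        (fun n hn w => by
          have h3 := hTBd n hn (swapXY w)
          rw [embTBCrossing_eq_embRectCrossing_reflect] at h3
          simpa using h3)
        (fun n hn w => by
          have h3 := hLRd n hn (swapXY w)
          rw [embRectCrossing_eq_embTBCrossing_reflect] at h3
          simpa using h3)
        hρ' hm (swapXY w')
      rw [embTBCrossing_eq_embRectCrossing_reflect]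
      simpa using h2
    have h8 : 2 * (4 / ρ) = 8 / ρ := by ring
    rw [h8] at hdual
    have hup := real_embRectCrossing_le_one_sub_of_dual_lower hiso hrh hclash hdual (ρ := ρ)
      (n := n) (by omega) ?_ ?_ w
    · refine le_trans hup ?_
      have : boxConst δ ρ ≤ δ ^ (⌈8 / ρ⌉₊ + 1) * δ ^ ⌈8 / ρ⌉₊ := by
        unfold boxConst
        rw [← pow_add]
        exact pow_le_pow_of_le_one hδ.le hδ1 (by omega)
      linarith
    · -- `max (n₀+4) 8 + 3 ≤ ρ n`
      have h1 : (((max (n₀ + 4) 8 : ℕ) : ℝ) + 3) / ρ ≤ n :=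
        le_trans (Nat.le_ceil _) (by exact_mod_cast hN2)
      rw [div_le_iff₀ hρ] at h1
      linarith
    · -- `n + 2 ≤ (8/ρ) (⌊ρ n⌋ - 2)`
      have h1 : (2 + 12 / ρ) / 3 + 1 ≤ n := by
        have := Nat.le_ceil ((2 + 12 / ρ) / 3)
        have h' : ((⌈(2 + 12 / ρ) / 3⌉₊ + 1 : ℕ) : ℝ) ≤ n := by exact_mod_cast hN3
        push_cast at h'
        linarith
      have hρn : (3 : ℝ) ≤ ρ * n := by
        have h1' : (((max (n₀ + 4) 8 : ℕ) : ℝ) + 3) / ρ ≤ n :=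
          le_trans (Nat.le_ceil _) (by exact_mod_cast hN2)
        rw [div_le_iff₀ hρ] at h1'
        have : (0 : ℝ) ≤ ((max (n₀ + 4) 8 : ℕ) : ℝ) := Nat.cast_nonneg _
        linarith
      have hfl3 : (3 : ℕ) ≤ ⌊ρ * n⌋₊ := Nat.le_floor (by exact_mod_cast hρn)
      have hm : ρ * n - 3 ≤ ((⌊ρ * n⌋₊ - 2 : ℕ) : ℝ) := by
        rw [Nat.cast_sub (by omega)]
        have := Nat.lt_floor_add_one (ρ * n)
        push_cast
        linarith
      have h12 : 12 / ρ * ρ = 12 := by field_simp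
      calc (n : ℝ) + 2 ≤ 4 * n - 12 / ρ := by nlinarith
        _ = 4 / ρ * (ρ * n - 3) := by field_simp; ring
        _ ≤ 4 / ρ * ((⌊ρ * n⌋₊ - 2 : ℕ) : ℝ) := by
            exact mul_le_mul_of_nonneg_left hm (by positivity)

/-- **Two-sided box-crossing bounds from aspect-ratio-2 crossings of `G` and `G*`.** Let `emb`
be an isoradial rhombic tiling with countably many vertices and faces and no vertex/face-centre
coincidences. If from scale `n₀` on, uniformly in translations, `P_G` crosses `2n × n` boxes
horizontally and `n × 2n` boxes vertically with probability `≥ δ`, and the canonical measure of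
the dual embedding does the same for the dual drawing, then for every `ρ > 0` the rendered
two-sided bounds `BoxCrossingBounds P_G z ρ (boxConst δ ρ) (boxScale n₀ ρ)` hold, with constants
depending only on `(δ, n₀, ρ)`. (Grimmett–Manolescu 2014: §2.3 for the reduction to aspect ratio
2, §2.2 and the end of §3 for the dual.) [cite: GrimmettManolescu2014Isoradial, §2.3, §2.2 and end of §3 (BXP for G and G*)] -/
theorem boxCrossingBounds_of_aspect_two (hiso : emb.IsIsoradial) (hrh : emb.IsRhombicTiling)
    (hclash : ∀ d D : G.Dart, emb.z d.fst ≠ emb.c (emb.leftFace D)) {δ : ℝ} (hδ : 0 < δ)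
    (hδ1 : δ ≤ 1) {n₀ : ℕ}
    (hLR : ∀ n : ℕ, n₀ ≤ n → ∀ w : ℂ,
      δ ≤ emb.isoradialPercolation.real (embRectCrossing (fun v => emb.z v - w) (2 * n) n))
    (hTB : ∀ n : ℕ, n₀ ≤ n → ∀ w : ℂ,
      δ ≤ emb.isoradialPercolation.real (embTBCrossing (fun v => emb.z v - w) n (2 * n)))
    (hLRd : ∀ n : ℕ, n₀ ≤ n → ∀ w : ℂ, δ ≤ emb.dual.isoradialPercolation.real
      (embRectCrossing (fun f => emb.dual.z f - w) (2 * n) n))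
    (hTBd : ∀ n : ℕ, n₀ ≤ n → ∀ w : ℂ, δ ≤ emb.dual.isoradialPercolation.real
      (embTBCrossing (fun f => emb.dual.z f - w) n (2 * n)))
    {ρ : ℝ} (hρ : 0 < ρ) :
    BoxCrossingBounds emb.isoradialPercolation emb.z ρ (boxConst δ ρ) (boxScale n₀ ρ) := by
  intro n hn w
  refine ⟨embRectCrossing_bounds_of_aspect_two hiso hrh hclash hδ hδ1 hLR hTB hLRd hTBd hρ hn w,
    ?_⟩
  -- the vertical half is the horizontal half for the reflected embedding
  have h := embRectCrossing_bounds_of_aspect_two (emb := emb.reflect) hiso.reflect hrh.reflect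
    (noClash_reflect hclash) hδ hδ1
    (fun n hn w => by
      have h3 := hTB n hn (swapXY w)
      rw [embTBCrossing_eq_embRectCrossing_reflect] at h3
      simpa using h3)
    (fun n hn w => by
      have h3 := hLR n hn (swapXY w)
      rw [embRectCrossing_eq_embTBCrossing_reflect] at h3
      simpa using h3)
    (fun n hn w => by
      have h3 := hTBd n hn (swapXY w)
      rw [embTBCrossing_eq_embRectCrossing_reflect] at h3
      have e1 : emb.reflect.dual.isoradialPercolation = emb.dual.isoradialPercolation :=
        isoradialPercolation_reflect emb.dual
      rw [e1]
      simpa using h3)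
    (fun n hn w => by
      have h3 := hLRd n hn (swapXY w)
      rw [embRectCrossing_eq_embTBCrossing_reflect] at h3
      have e1 : emb.reflect.dual.isoradialPercolation = emb.dual.isoradialPercolation :=
        isoradialPercolation_reflect emb.dual
      rw [e1]
      simpa using h3)
    hρ hn (swapXY w)
  rw [embTBCrossing_eq_embRectCrossing_reflect]
  simpa using h

/-- **Corollary: the box-crossing property** `HasBoxCrossingProperty P_G z` from the same
inputs. [cite: GrimmettManolescu2014Isoradial, §2.3, §2.2 and end of §3 (BXP for G and G*)] -/
theorem hasBoxCrossingProperty_of_aspect_two (hiso : emb.IsIsoradial) (hrh : emb.IsRhombicTiling)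
    (hclash : ∀ d D : G.Dart, emb.z d.fst ≠ emb.c (emb.leftFace D)) {δ : ℝ} (hδ : 0 < δ)
    (hδ1 : δ ≤ 1) {n₀ : ℕ}
    (hLR : ∀ n : ℕ, n₀ ≤ n → ∀ w : ℂ,
      δ ≤ emb.isoradialPercolation.real (embRectCrossing (fun v => emb.z v - w) (2 * n) n))
    (hTB : ∀ n : ℕ, n₀ ≤ n → ∀ w : ℂ,
      δ ≤ emb.isoradialPercolation.real (embTBCrossing (fun v => emb.z v - w) n (2 * n)))
    (hLRd : ∀ n : ℕ, n₀ ≤ n → ∀ w : ℂ, δ ≤ emb.dual.isoradialPercolation.real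
      (embRectCrossing (fun f => emb.dual.z f - w) (2 * n) n))
    (hTBd : ∀ n : ℕ, n₀ ≤ n → ∀ w : ℂ, δ ≤ emb.dual.isoradialPercolation.real
      (embTBCrossing (fun f => emb.dual.z f - w) n (2 * n))) :
    HasBoxCrossingProperty emb.isoradialPercolation emb.z := fun ρ hρ =>
  ⟨boxConst δ ρ, boxConst_pos hδ ρ, boxScale n₀ ρ,
    boxCrossingBounds_of_aspect_two hiso hrh hclash hδ hδ1 hLR hTB hLRd hTBd hρ⟩

end Assembly

end Literature.Probability.Percolation

end
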